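import Summits.ResolutionOfSingularities.ResolutionOfSingularities.Theorems.FrobeniusClosingPatchingRelPerfectDepthSepFormatStep
import Summits.ResolutionOfSingularities.ResolutionOfSingularities.Theorems.FrobeniusClosingPatchingRelPerfectDepthEndTwoMonomialSepGlue
import Summits.ResolutionOfSingularities.ResolutionOfSingularities.Theorems.FrobeniusClosingPatchingRelPerfectDepthSepTargets
import HarnessLib

/-!
# Chain W5.2 — F6 STAGE 2: the X-side targets `StepSepOne` and `EndTwoMonomialSep` CLOSED BY NAME for `Q := SepFormat`

[OURS · L1 W5.2 · res-D-pv-016 AS res-L1-w52-stub-5, T6-X2 OWNER (res-L1-w52-plan-1 RULINGS 2026-08-27T09:17:34Z (3), STEER 3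
10:30:22Z (2)); by-name closers over TargetsF6 module 2 `…DepthSepTargets` (res-D-pv-059 AS lead-2).]  NOT statements of the
manuscript under review; AI-written, weaker than expert review; fact-free.

* `stepSepOne_sepFormat : StepSepOne SepFormat` — res-D-pv-016's `DepthGraded.SepFormat.step` (`…DepthSepFormatStep`, over the
  pointwise KEY `…DepthSepFormatStepKey` and `…DepthSepFormatStepLemmas`; res-D-pv-009's swaps, res-D-pv-021's cotangent
  readings, res-D-pv-052's host lift and traces bookkeeping, res-type-049's (L-A)/(L-C));
* `endTwoMonomialSep_sepFormat : EndTwoMonomialSep SepFormat` — res-D-pv-009's `DepthGraded.SepFormat.exists_endTwoMonomial`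
  (`…DepthEndTwoMonomialSepGlue`, p522795: host lift on `i(E)`, the coincidence lift `sncWithAt_host_cons_of_coincidence_top`,
  the pocket field off `i(E)`, assembled by `exists_endTwoMonomial_of_halves`) after destructuring `EndSep`.

With `towerSep_of_stepSepOne` and `sepEngine_of_targets` (module 3 `…DepthFlagSepCompositions`, once filed) and
res-L1-w52-stub-1's `pointwisePairGame_holds`, the stage-2 ENGINE `SepEngine SepFormat` follows unconditionally (appended here
when module 3 lands); the E-side driver `SeparationBoundary₃` (res-L1-w52-stub-1, mod F-32bR) and the stage-1 bridge
`InitialSep FlagFormat SepFormat` are outside this file. [cite: BierstoneGrigorievMilmanWlodarczyk2011, §4 Step 2a/2b] [cite: Kollar2007, (3.111) Step 3, Cor. 3.85]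
-/

-- `Summit.<Summit>.<Sub>.Theorems` with `Sub = Summit` (single-conjunct summit, D-0017)
set_option linter.dupNamespace false

noncomputable section

open CategoryTheory CategoryTheory.Limits AlgebraicGeometry TopologicalSpace IsLocalRing
open Literature.AlgebraicGeometry.Resolution

namespace Summit.ResolutionOfSingularities.ResolutionOfSingularities.Theorems.DepthTargets

universe u

/-- [OURS · L1 W5.2] **`StepSepOne SepFormat`** — the formatted weight-one step of stage 2 holds for res-D-pv-016's format
(content: `DepthGraded.SepFormat.step`). [cite: BierstoneGrigorievMilmanWlodarczyk2011, §3.2 Lemma 3.2.1, §4 Step 2a]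
[cite: Kollar2007, (3.111) Step 3, Cor. 3.85] -/
theorem stepSepOne_sepFormat : StepSepOne DepthGraded.SepFormat.{u} :=
  fun S _ _ I E X i g K N 𝒟 hinv hQ E' τ C hC hconn hle hsnc hU hjoint hτ =>
    DepthGraded.SepFormat.step S I E X i g K N 𝒟 hinv hQ E' τ C hC hconn hle hsnc hU hjoint hτ

/-- [OURS · L1 W5.2] **`EndTwoMonomialSep SepFormat`** — the two-monomial END of stage 2 holds for res-D-pv-016's format
(content: res-D-pv-009's `DepthGraded.SepFormat.exists_endTwoMonomial`, p522795, after destructuring `EndSep`).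
[cite: Kollar2007, (3.111) Step 3, Cor. 3.85] [cite: BierstoneGrigorievMilmanWlodarczyk2011, §4 Step 2b] -/
theorem endTwoMonomialSep_sepFormat : EndTwoMonomialSep DepthGraded.SepFormat.{u} :=
  fun _ _ _ _ _ _ _ _ _ _ _ hinv hQ hend =>
    DepthGraded.SepFormat.exists_endTwoMonomial hinv hQ (fun y hy => (hend y hy).1) (fun y hy => (hend y hy).2.1)
      (fun y hy => (hend y hy).2.2)

end Summit.ResolutionOfSingularities.ResolutionOfSingularities.Theorems.DepthTargets

end
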